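import Mathlib
import Summits.Ventures.HodgeRepro2.T5HalfPlaneIdentity
import Summits.Ventures.HodgeRepro2.T6N41Core

/-!
# T6N41Glue — from Euler-product identities on a half-plane to the core of N4.1 (pre-M2, carrier-free)

The core `N41Core.core` takes the factorisation `Λ = Z·L₁·L₂` as an identity on a punctured
neighbourhood of the point `x` (= `s = 1`).  At M2 the datum supplies it as an identity of
(absolutely convergent) Euler products on a half-plane `Re s > σ₀` (route/T5-N4.1-route-1.md (P0),
(P3), (P7)), together with meromorphy on `ℂ` of every function involved (Lapid–Rallis Thm 4(10) for
`Λ`, Iwasawa Thm 3.1 for the Hecke L-functions, the (P2) lemmas of `T6N41Core` for the finitely many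
local factors).  This file supplies the bridge — the identity theorem for functions meromorphic on
`ℂ` — and restates the core and the (R1) shapes with the half-plane hypothesis:

* `eventuallyEq_of_meromorphicOn_of_eqOn_open`: two functions meromorphic on `ℂ` that agree on a
  non-empty open set agree on a punctured neighbourhood of every point (Mathlib's
  `MeromorphicOn.exists_meromorphicOrderAt_ne_top_iff_forall_mem` applied to the difference);
* `eventuallyEq_of_meromorphicOn_of_eqOn_halfPlane`: the same for a half-plane `Re s > σ₀` (its
  openness is p1's accepted `T5HalfPlaneIdentity.isOpen_halfPlane`, imported by name);
* `core_of_halfPlane`, `R1_complete_of_halfPlane`: `N41Core.core` / `R1_complete` with the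
  factorisation given on a half-plane and meromorphy on `ℂ`.

Nothing is displayed here (TARGET-T6 §7(c)); no datum is fixed.  §8(d): uses an L-value-free
non-vanishing device: NO.
-/

namespace Summit.Ventures.HodgeRepro2.T6
namespace N41Core

open Filter Topology

/-- The right half-plane `{s | σ₀ < Re s}` is non-empty. -/
theorem nonempty_halfPlane (σ₀ : ℝ) : ({s : ℂ | σ₀ < s.re} : Set ℂ).Nonempty :=
  ⟨((σ₀ + 1 : ℝ) : ℂ), by simp⟩

/-- **Identity theorem for functions meromorphic on `ℂ`.** If `f` and `g` are meromorphic on all of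
`ℂ` and agree on a non-empty open set `V`, then `f = g` on a punctured neighbourhood of every point
`x` (the difference has infinite order at a point of `V`, hence — `ℂ` being connected — at every
point). -/
theorem eventuallyEq_of_meromorphicOn_of_eqOn_open {f g : ℂ → ℂ}
    (hf : MeromorphicOn f Set.univ) (hg : MeromorphicOn g Set.univ) {V : Set ℂ} (hV : IsOpen V)
    (hne : V.Nonempty) (heq : Set.EqOn f g V) (x : ℂ) : f =ᶠ[𝓝[≠] x] g := by
  have hsub : MeromorphicOn (f - g) Set.univ := hf.sub hg
  obtain ⟨x₀, hx₀⟩ := hne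
  have h0 : meromorphicOrderAt (f - g) x₀ = ⊤ := by
    rw [meromorphicOrderAt_eq_top_iff]
    have : ∀ᶠ z in 𝓝 x₀, (f - g) z = 0 := by
      filter_upwards [hV.mem_nhds hx₀] with z hz
      simp [heq hz]
    exact this.filter_mono nhdsWithin_le_nhds
  have hall : ∀ u ∈ Set.univ, meromorphicOrderAt (f - g) u = ⊤ := by
    intro u _
    by_contra hu
    exact (hsub.exists_meromorphicOrderAt_ne_top_iff_forall_mem isConnected_univ).1
      ⟨u, trivial, hu⟩ x₀ trivial h0
  have hx : ∀ᶠ z in 𝓝[≠] x, (f - g) z = 0 := meromorphicOrderAt_eq_top_iff.1 (hall x trivial)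
  filter_upwards [hx] with z hz
  exact sub_eq_zero.1 hz

/-- The identity theorem with the open set a right half-plane `Re s > σ₀` — the shape of an
Euler-product identity valid in the region of absolute convergence. -/
theorem eventuallyEq_of_meromorphicOn_of_eqOn_halfPlane {f g : ℂ → ℂ}
    (hf : MeromorphicOn f Set.univ) (hg : MeromorphicOn g Set.univ) {σ₀ : ℝ}
    (heq : ∀ s : ℂ, σ₀ < s.re → f s = g s) (x : ℂ) : f =ᶠ[𝓝[≠] x] g :=
  eventuallyEq_of_meromorphicOn_of_eqOn_open hf hg (T5HalfPlaneIdentity.isOpen_halfPlane σ₀)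
    (nonempty_halfPlane σ₀) (fun _ hs => heq _ hs) x

/-- The factorisation hypothesis of `core` from its half-plane form: `Λ`, `Z`, `L₁`, `L₂`
meromorphic on `ℂ` and `Λ = Z·L₁·L₂` for `Re s > σ₀`. -/
theorem factorisation_of_halfPlane {Λ Z L₁ L₂ : ℂ → ℂ}
    (hΛm : MeromorphicOn Λ Set.univ) (hZm : MeromorphicOn Z Set.univ)
    (h₁m : MeromorphicOn L₁ Set.univ) (h₂m : MeromorphicOn L₂ Set.univ) {σ₀ : ℝ}
    (heq : ∀ s : ℂ, σ₀ < s.re → Λ s = Z s * L₁ s * L₂ s) (x : ℂ) :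
    Λ =ᶠ[𝓝[≠] x] Z * L₁ * L₂ :=
  eventuallyEq_of_meromorphicOn_of_eqOn_halfPlane hΛm ((hZm.mul h₁m).mul h₂m) heq x

/-- `N41Core.core` with the factorisation given on a half-plane and meromorphy on `ℂ`
(the datum's shape at M2). -/
theorem core_of_halfPlane {x : ℂ} {Λ Z L₁ L₂ : ℂ → ℂ} {η₁triv η₂triv : Prop}
    (hΛm : MeromorphicOn Λ Set.univ) (hZm : MeromorphicOn Z Set.univ)
    (h₁m : MeromorphicOn L₁ Set.univ) (h₂m : MeromorphicOn L₂ Set.univ) {σ₀ : ℝ}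
    (heq : ∀ s : ℂ, σ₀ < s.re → Λ s = Z s * L₁ s * L₂ s)
    (hZ0 : meromorphicOrderAt Z x ≤ 0)
    (hI₁ : η₁triv → meromorphicOrderAt L₁ x = -1)
    (hI₁' : ¬ η₁triv → AnalyticAt ℂ L₁ x ∧ L₁ x ≠ 0)
    (hI₂ : η₂triv → meromorphicOrderAt L₂ x = -1)
    (hI₂' : ¬ η₂triv → AnalyticAt ℂ L₂ x ∧ L₂ x ≠ 0)
    (hhol : AnalyticAt ℂ Λ x) :
    ¬ η₁triv ∧ ¬ η₂triv ∧ Λ x ≠ 0 ∧ meromorphicOrderAt Z x = 0 :=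
  core (factorisation_of_halfPlane hΛm hZm h₁m h₂m heq x) (hZm x trivial) hZ0 (h₁m x trivial)
    (h₂m x trivial) hI₁ hI₁' hI₂ hI₂' hhol

/-- The (R1) shape with the factorisation given on a half-plane and meromorphy on `ℂ`. -/
theorem R1_complete_of_halfPlane {x : ℂ} {Λ Z L₁ L₂ : ℂ → ℂ} {η₁triv η₂triv : Prop}
    (hΛm : MeromorphicOn Λ Set.univ) (hZm : MeromorphicOn Z Set.univ)
    (h₁m : MeromorphicOn L₁ Set.univ) (h₂m : MeromorphicOn L₂ Set.univ) {σ₀ : ℝ}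
    (heq : ∀ s : ℂ, σ₀ < s.re → Λ s = Z s * L₁ s * L₂ s)
    (hZ0 : meromorphicOrderAt Z x ≤ 0)
    (hI₁ : η₁triv → meromorphicOrderAt L₁ x = -1)
    (hI₁' : ¬ η₁triv → AnalyticAt ℂ L₁ x ∧ L₁ x ≠ 0)
    (hI₂ : η₂triv → meromorphicOrderAt L₂ x = -1)
    (hI₂' : ¬ η₂triv → AnalyticAt ℂ L₂ x ∧ L₂ x ≠ 0)
    (hhol : AnalyticAt ℂ Λ x) : AnalyticAt ℂ Λ x ∧ Λ x ≠ 0 :=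
  ⟨hhol, (core_of_halfPlane hΛm hZm h₁m h₂m heq hZ0 hI₁ hI₁' hI₂ hI₂' hhol).2.2.1⟩

/-- (P2) in kernel, global form: a finite-place factor `1/P(q^{-s})` is meromorphic on `ℂ`. -/
theorem meromorphicOn_inv_eval_cpow (P : Polynomial ℂ) {q : ℝ} (hq : 0 < q) :
    MeromorphicOn (fun s : ℂ => (P.eval ((q : ℂ) ^ (-s)))⁻¹) Set.univ :=
  fun x _ => meromorphicAt_inv_eval_cpow P hq x

/-- (P2) in kernel, global form: a Γ-factor `Γ(a s + b)` is meromorphic on `ℂ`. -/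
theorem meromorphicOn_Gamma_affine (a b : ℂ) :
    MeromorphicOn (fun s => Complex.Gamma (a * s + b)) Set.univ :=
  fun x _ => meromorphicAt_Gamma_affine a b x

/-- A finite product of functions meromorphic on `ℂ` is meromorphic on `ℂ`. -/
theorem meromorphicOn_prod {ι : Type*} {s : Finset ι} {f : ι → ℂ → ℂ}
    (hf : ∀ i ∈ s, MeromorphicOn (f i) Set.univ) :
    MeromorphicOn (∏ i ∈ s, f i) Set.univ :=
  fun x _ => MeromorphicAt.prod fun i hi => hf i hi x trivial

end N41Core
end Summit.Ventures.HodgeRepro2.T6
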